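import Summits.BirchSwinnertonDyer.BirchSwinnertonDyer.Theorems.CMKolyvaginAtInertTwoCebotarevBinderPairDeeperAtTwo
import Summits.BirchSwinnertonDyer.BirchSwinnertonDyer.Theorems.CMKolyvaginAtInertTwoCebotarevBinderTransferAtTwo
import Summits.BirchSwinnertonDyer.BirchSwinnertonDyer.Theorems.CMKolyvaginAtInertTwoLiftGroupsAllAtTwo
import Summits.BirchSwinnertonDyer.BirchSwinnertonDyer.Theorems.CMKolyvaginAtInertTwoAdaptiveDataTelescopeMemW
import HarnessLib

/-!
# Route `CMKolyvaginAtInertTwo`, crux `CMKolyvaginExactAtInertTwo` (stmt-BirchSwinnertonDyer-24277):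
# McCALLUM'S INEQUALITY `#A · #S₂ ≤ 2^{2M₀}` ON ANY CARRIER MAPPED INJECTIVELY INTO THE PAIR —
# WITH THE KILL CLAUSE `(p^k) • t = 0` EXPOSED TO THE CASSELS–TATE VALUE FORMULA

Seat `bsd-line-cmk2-p1` g17 (cell `bsd-print-cf2`); helper (`--supports stmt-BirchSwinnertonDyer-24277`).
THEOREMS ONLY: no definition, no named fact, no `sorry`; no item is closed; BSD is not proved by this.

T2 KIT INTERFACE REPAIR (KERNEL-STATUS-p2-port.md §17). Seat g14's
`card_mul_card_le_two_pow_two_mul_of_injective` (p690708) asks McCallum's value formula `hCTV` for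
every test class `t ∈ Sd.Sel` of order `p^{N'}`, `N' + M₀ ≤ M`. The member formulas over `ℚ` that
supply `hCTV` through `hCTV_of_members` (`hV₁/hV₂_canonical_of_kill`, p708946: McCallum Prop. 4.7 +
Lemma 5.3 for `E`, `E^{(d_K)}` at level `2^L` inside the `2^{2L}`-carrier) need the test class KILLED
BY `2^L` (first-case data of the level-`2^L` Cassels–Tate pairing; displayed there as
`2^{2M₀} • t = 0`, `2M₀ ≤ L`), which `N' ≤ 2L − M₀` does not give. Here the same theorem is proved
with `hCTV` asked only under the extra displayed hypothesis **`(p^k) • t = 0`**, `k` the exponent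
with `2^k · A = 0`, `2^k · S₂ = 0` (`A = Ш(E^{ε}/ℚ)[2^∞]`, `S₂ = Sel_{2^M}(E^{−ε}/ℚ)`, finite): the
telescope meets `hCTV` only on the isotropic subgroup `J₁(Zp) ⊔ J₂(Zm)` of the lift groups
(`KolyvaginAdaptiveData.card_mul_card_le_of_casselsTate_adaptive_memW`), which `p^k` kills. In the
assembly take `L ≥ max(k, 2μ)` and feed the member formulas at `M₀ := μ = max(M₀, ⌈k/2⌉)` (their
`M₀` is numeric only). Proof VERBATIM g14's otherwise.

* `card_mul_card_le_two_pow_two_mul_of_injective_of_kill`.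

References: [McCallumLMS1991] §1 Theorem, §5 Thm. 5.4 (p. 307), Cor. 5.6; [Kolyvagin1989Izv] §3.
-/

-- single-conjunct summit: `Summit.BirchSwinnertonDyer.BirchSwinnertonDyer.…` repeats the name by design
set_option linter.dupNamespace false
set_option autoImplicit false

noncomputable section

open scoped Classical
open WeierstrassCurve NumberField IsDedekindDomain Field
open Literature.NumberTheory.GaloisRepresentations
open Literature.NumberTheory.EllipticCurves Literature.NumberTheory.EllipticCurves.KolyvaginDescent

namespace Summit.BirchSwinnertonDyer.BirchSwinnertonDyer.Theorems.KolyvaginPairDataTwo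

open KolyvaginAdaptiveData

variable {N : ℕ} (W : WeierstrassCurve ℚ) {K : Type} [Field K] [NumberField K] (c : K ≃ₐ[ℚ] K) (M : ℕ)

-- the product-of-subtypes carrier `PairV` makes instance unification slow (`addOrderOf`, `•`)
set_option maxHeartbeats 800000 in
/-- **McCallum's inequality `#A · #S₂ ≤ 2^{2M₀}` for split descent data on any carrier mapped
injectively and compatibly into the pair, the Cassels–Tate value formula `hCTV` being asked only for
test classes `t` with `(p^k) • t = 0`** (`k` the displayed kill exponent of `A` and `S₂`). See the
module docstring. [cite: McCallumLMS1991, §5 Thm. 5.4 (proof, p. 307), Cor. 5.6] [cite: Kolyvagin1989Izv, §3] -/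
theorem card_mul_card_le_two_pow_two_mul_of_injective_of_kill
    (hC : Literature.NumberTheory.Automorphic.chebotarev_artinRep)
    [NeZero N] [W.IsElliptic] (hK : IsImaginaryQuadratic K) (hρ : W.HasSurjectiveModNGaloisRep 2)
    (hΔ : W.Δ < 0) (hΔK : ¬ IsSquare (W.baseChange K).Δ) (hc : c ≠ 1)
    {c₀ : absoluteGaloisGroup ℚ} (hc₀ : IsComplexConjugation (Rat.castHom ℝ) c₀)
    {z : absoluteGaloisGroup K}
    (hzfix : ∀ P : geomTorsion (W.baseChange K) ((2 : ℕ) : ℤ), z • P = P → P = 0)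
    (hcomm : ∀ π ∈ torsionFixing (W.baseChange K) ((2 : ℕ) : ℤ),
      ∀ P : geomTorsion (W.baseChange K) ((2 ^ (M + 1) : ℕ) : ℤ), π • z • P = z • π • P)
    {S : ℕ → Prop}
    (hS : ∀ ℓ, IsKolyvaginPrime N W K 2 ℓ → FrobEqFrobInfty W K (2 ^ (M + 1)) ℓ → S ℓ)
    {P₀ : (W.baseChange K).toAffine.Point} (hP₀ : IsHeegnerPoint N W K P₀)
    {ε : ℤ} (hε : ε = 1 ∨ ε = -1)
    -- the carrier, mapped injectively into the pair
    {V' : Type*} [AddCommGroup V'] (f : V' →+ PairV W c M ε) (hf : Function.Injective f)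
    {Pl : Type*} (Sd : SplitDataM V' Pl) (hp : Sd.p = 2)
    (heig : ∀ (e : ℤ) (v : V'), v ∈ Sd.eig e ↔ f v ∈ pairEig W c M ε e)
    (Δ' : AddSubgroup V') (hΔ' : ∀ v, v ∈ Δ' ↔ f v ∈ pairDelta W c M ε)
    (hA : ∀ ℓ, Sd.Kol ℓ → ∀ v, v ∈ Sd.A ℓ ↔ f v ∈ pairA (N := N) W c M ε ℓ)
    (hKol : ∀ ℓ, Sd.Kol ℓ ↔ IsKolyvaginPrime N W K 2 ℓ ∧ FrobEqFrobInfty W K (2 ^ (M + 1)) ℓ ∧ S ℓ)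
    (hSdε : Sd.ε = ε)
    -- the kill exponent of the lift groups (`2^k` kills `A` and `S₂` below), exposed to `hCTV`
    (k : ℕ)
    {R : Type*} [AddCommGroup R] (P : Sd.Sel →+ Sd.Sel →+ R)
    (hCTV : ∀ ℓ m : ℕ, Sd.Kol ℓ → KolSupp Sd.Kol (ℓ * m) → ¬ ℓ ∣ m →
      ∀ (j N' a b : ℕ) (t : V') (ht : t ∈ Sd.Sel) (hz : ((Sd.p : ℤ) ^ j) • Sd.c (ℓ * m) ∈ Sd.Sel),
      ((Sd.p : ℤ) ^ k) • t = 0 → ((Sd.p : ℤ) ^ N') • t = 0 → t ∈ Sd.eig (Sd.ε * (-1) ^ (ℓ * m).primeFactors.card) →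
      (∀ q ∈ m.primeFactors, t ∈ Sd.A q) → Sd.M - Sd.M₀ ≤ j → N' + Sd.M₀ ≤ Sd.M → N' ≤ j →
      a + b + 1 = N' →
      ((Sd.p : ℤ) ^ (a + (j - N'))) • Sd.c m ∉ Sd.A ℓ → ((Sd.p : ℤ) ^ b) • t ∉ Sd.A ℓ →
      P ⟨_, hz⟩ ⟨t, ht⟩ ≠ 0)
    -- the abstract `ℚ`-side data
    {S₁ : Type} [AddCommGroup S₁] [Finite S₁] {S₂ : Type} [AddCommGroup S₂] [Finite S₂]
    {A : Type} [AddCommGroup A]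
    (π : S₁ →+ A) (hπ : Function.Surjective π) (x : S₁)
    (hker : π.ker = AddSubgroup.zmultiples x) (hx : addOrderOf x = AddMonoid.exponent S₁)
    (BA : A →+ A →+ AddCircle (1 : ℚ)) (hAalt : ∀ a, BA a a = 0)
    (hAnd : ∀ a, (∀ b, BA a b = 0) → a = 0)
    (BB : S₂ →+ S₂ →+ AddCircle (1 : ℚ)) (hBalt : ∀ v, BB v v = 0)
    (hBnd : ∀ v, (∀ w, BB v w = 0) → v = 0) (hpA : ∀ a : A, 2 ^ k • a = 0)
    (hpB : ∀ v : S₂, 2 ^ k • v = 0)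
    (J₁ : S₁ →+ V') (J₂ : S₂ →+ V') (hJ₁ : Function.Injective J₁) (hJ₂ : Function.Injective J₂)
    (hJ₁ε : ∀ u, (f (J₁ u)).2 = 0) (hJ₂ε : ∀ v, (f (J₂ v)).1 = 0)
    -- compatibility
    (hxSd : Sd.x = J₁ x)
    (hSel : ∀ (u : S₁) (v : S₂), J₁ u + J₂ v ∈ Sd.Sel)
    (hP : ∀ (u u' : S₁) (v v' : S₂), BA (π u) (π u') = 0 → BB v v' = 0 →
      P ⟨J₁ u + J₂ v, hSel u v⟩ ⟨J₁ u' + J₂ v', hSel u' v'⟩ = 0)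
    (hkM : k + Sd.M₀ ≤ Sd.M) :
    Nat.card A * Nat.card S₂ ≤ 2 ^ (2 * Sd.M₀) := by
  -- ### the two injections into `H¹(K, E[2^M])`
  set r₁ : S₁ →+ galH1Torsion (W.baseChange K) ((2 ^ M : ℕ) : ℤ) :=
    (eigK W c M ε).subtype.comp ((AddMonoidHom.fst _ _).comp (f.comp J₁)) with hr₁def
  set r₂ : S₂ →+ galH1Torsion (W.baseChange K) ((2 ^ M : ℕ) : ℤ) :=
    (eigK W c M (-ε)).subtype.comp ((AddMonoidHom.snd _ _).comp (f.comp J₂)) with hr₂def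
  have hr₁a : ∀ u, r₁ u = ((f (J₁ u)).1 : galH1Torsion (W.baseChange K) ((2 ^ M : ℕ) : ℤ)) :=
    fun _ ↦ rfl
  have hr₂a : ∀ v, r₂ v = ((f (J₂ v)).2 : galH1Torsion (W.baseChange K) ((2 ^ M : ℕ) : ℤ)) :=
    fun _ ↦ rfl
  have hfJ₁ : ∀ u : S₁, (f (J₁ u)).1 = 0 → u = 0 := by
    intro u hu
    apply hJ₁
    apply hf
    rw [map_zero, map_zero]
    exact Prod.ext hu (hJ₁ε u)
  have hfJ₂ : ∀ v : S₂, (f (J₂ v)).2 = 0 → v = 0 := by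
    intro v hv
    apply hJ₂
    apply hf
    rw [map_zero, map_zero]
    exact Prod.ext (hJ₂ε v) hv
  have hr₁ : Function.Injective r₁ := by
    refine (injective_iff_map_eq_zero r₁).mpr fun u hu ↦ hfJ₁ u ?_
    rw [hr₁a] at hu
    exact Subtype.ext (by rw [hu]; rfl)
  have hr₂ : Function.Injective r₂ := by
    refine (injective_iff_map_eq_zero r₂).mpr fun v hv ↦ hfJ₂ v ?_
    rw [hr₂a] at hv
    exact Subtype.ext (by rw [hv]; rfl)
  -- ### the lift groups (T5′)
  obtain ⟨Zp, Zm, hdisj, hisoA, hcardA, hisoB, hcardB, hINDa⟩ :=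
    KolyvaginLiftGroupsTwo.exists_liftGroups Nat.prime_two π hπ x hker hx BA hAalt hAnd BB hBalt hBnd
      hpA hpB r₁ r₂ hr₁ hr₂
  set Zp' : AddSubgroup V' := Zp.map J₁ with hZp'
  set Zm' : AddSubgroup V' := Zm.map J₂ with hZm'
  haveI : Finite Zp' :=
    Finite.of_surjective (fun a : Zp ↦ (⟨J₁ a, AddSubgroup.mem_map_of_mem J₁ a.2⟩ : Zp'))
      fun y ↦ by
        obtain ⟨a, ha, hay⟩ := AddSubgroup.mem_map.mp y.2
        exact ⟨⟨a, ha⟩, Subtype.ext hay⟩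
  haveI : Finite Zm' :=
    Finite.of_surjective (fun b : Zm ↦ (⟨J₂ b, AddSubgroup.mem_map_of_mem J₂ b.2⟩ : Zm'))
      fun y ↦ by
        obtain ⟨b, hb, hby⟩ := AddSubgroup.mem_map.mp y.2
        exact ⟨⟨b, hb⟩, Subtype.ext hby⟩
  have hdec : ∀ w ∈ Zp' ⊔ Zm', ∃ a ∈ Zp, ∃ b ∈ Zm, w = J₁ a + J₂ b := by
    intro w hw
    obtain ⟨y, hy, y', hy', hsum⟩ := AddSubgroup.mem_sup.mp hw
    obtain ⟨a, ha, rfl⟩ := AddSubgroup.mem_map.mp hy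
    obtain ⟨b, hb, rfl⟩ := AddSubgroup.mem_map.mp hy'
    exact ⟨a, ha, b, hb, hsum.symm⟩
  -- `2^k` kills the lift groups
  have hkZp : ∀ a ∈ Zp, 2 ^ k • a = 0 := by
    intro a ha
    have h1 : 2 ^ k • a ∈ π.ker := by rw [AddMonoidHom.mem_ker, map_nsmul, hpA]
    rw [hker] at h1
    have h2 := hdisj.le_bot (AddSubgroup.mem_inf.mpr ⟨h1, AddSubgroup.nsmul_mem _ ha _⟩)
    rwa [AddSubgroup.mem_bot] at h2
  -- ### the telescope's hypotheses
  have hZpε : ∀ w ∈ Zp', w ∈ Sd.Sel ∧ w ∈ Sd.eig Sd.ε := by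
    intro w hw
    obtain ⟨a, -, rfl⟩ := AddSubgroup.mem_map.mp hw
    refine ⟨by simpa using hSel a 0, ?_⟩
    rw [heig, hSdε, pairEig_self, AddSubgroup.mem_prod]
    exact ⟨AddSubgroup.mem_top _, by rw [hJ₁ε]; exact zero_mem _⟩
  have hZmε : ∀ w ∈ Zm', w ∈ Sd.Sel ∧ w ∈ Sd.eig (-Sd.ε) := by
    intro w hw
    obtain ⟨b, -, rfl⟩ := AddSubgroup.mem_map.mp hw
    refine ⟨by simpa using hSel 0 b, ?_⟩
    rw [heig, hSdε, pairEig_neg W c M hε, AddSubgroup.mem_prod]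
    exact ⟨by rw [hJ₂ε]; exact zero_mem _, AddSubgroup.mem_top _⟩
  have hiso : ∀ u, ∀ hu : u ∈ Zp' ⊔ Zm', ∀ v, ∀ hv : v ∈ Zp' ⊔ Zm',
      ∀ (hu' : u ∈ Sd.Sel) (hv' : v ∈ Sd.Sel), P ⟨u, hu'⟩ ⟨v, hv'⟩ = 0 := by
    intro u hu v hv hu' hv'
    obtain ⟨a, ha, b, hb, rfl⟩ := hdec u hu
    obtain ⟨a', ha', b', hb', rfl⟩ := hdec v hv
    exact hP a a' b b' (hisoA a ha a' ha') (hisoB b hb b' hb')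
  have hind : AddSubgroup.zmultiples Sd.x ⊓ (Zp' ⊔ Zm') = ⊥ := by
    rw [hxSd, AddSubgroup.eq_bot_iff_forall]
    intro w hw
    obtain ⟨hw1, hw2⟩ := AddSubgroup.mem_inf.mp hw
    obtain ⟨n, hn⟩ := AddSubgroup.mem_zmultiples_iff.mp hw1
    obtain ⟨a, ha, b, hb, hwab⟩ := hdec w hw2
    -- `J₁ (n•x - a) = J₂ b`; apply `f` and read components
    have hJ : J₁ (n • x - a) = J₂ b := by
      rw [map_sub, map_zsmul, hn, hwab]; abel
    have hb0 : b = 0 := by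
      apply hfJ₂
      rw [← hJ]
      exact hJ₁ε _
    have ha0 : n • x - a = 0 := by
      apply hJ₁
      rw [hJ, hb0, map_zero, map_zero]
    have hax : a ∈ AddSubgroup.zmultiples x := by
      rw [sub_eq_zero] at ha0
      rw [← ha0]
      exact AddSubgroup.zsmul_mem _ (AddSubgroup.mem_zmultiples x) n
    have ha00 : a = 0 := by
      have h := hdisj.le_bot (AddSubgroup.mem_inf.mpr ⟨hax, ha⟩)
      rwa [AddSubgroup.mem_bot] at h
    rw [hwab, ha00, hb0, map_zero, map_zero, add_zero]
  have hIND : (Zp' ⊔ Δ') ⊓ Zm' = ⊥ := by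
    rw [AddSubgroup.eq_bot_iff_forall]
    intro w hw
    obtain ⟨hw1, hw2⟩ := AddSubgroup.mem_inf.mp hw
    obtain ⟨b, hb, rfl⟩ := AddSubgroup.mem_map.mp hw2
    obtain ⟨y, hy, d, hd, hsum⟩ := AddSubgroup.mem_sup.mp hw1
    obtain ⟨a, ha, rfl⟩ := AddSubgroup.mem_map.mp hy
    rw [hΔ', mem_pairDelta_iff] at hd
    -- components of `f (J₂ b) = f (J₁ a) + f d`
    have hfe : f (J₂ b) = f (J₁ a) + f d := by rw [← map_add, hsum]
    have h1 : (f d).1 = -(f (J₁ a)).1 := by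
      have h := congrArg Prod.fst hfe
      rw [hJ₂ε, Prod.fst_add] at h
      exact (neg_eq_of_add_eq_zero_right h.symm).symm
    have h2 : (f d).2 = (f (J₂ b)).2 := by
      have h := congrArg Prod.snd hfe
      rw [Prod.snd_add, hJ₁ε, zero_add] at h
      exact h.symm
    rw [h1, h2, AddSubgroup.coe_neg, neg_add_eq_zero] at hd
    have hrr : r₁ a = r₂ b := by rw [hr₁a, hr₂a]; exact hd
    rw [(hINDa a ha b hb hrr).2, map_zero]
  have hroom : ∀ w ∈ Zp' ⊔ Zm', Sd.expo w + Sd.M₀ ≤ Sd.M := by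
    intro w hw
    obtain ⟨a, ha, b, hb, rfl⟩ := hdec w hw
    have hv0 : ((Sd.p : ℤ) ^ k) • (J₁ a + J₂ b) = 0 := by
      rw [hp, ← Nat.cast_pow, natCast_zsmul, smul_add, ← map_nsmul, ← map_nsmul, hkZp a ha, hpB,
        map_zero, map_zero, add_zero]
    have hle : Sd.expo (J₁ a + J₂ b) ≤ k := (Sd.expo_le_iff _ k).mpr hv0
    omega
  have hΔpure : ∀ d ∈ Δ', ∀ e : ℤ, (e = 1 ∨ e = -1) → d ∈ Sd.eig e → d = 0 := by
    intro d hd e _ hde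
    apply hf
    rw [map_zero]
    exact eq_zero_of_mem_pairDelta_of_mem_pairEig W c M hε (f d) ((hΔ' d).mp hd) e ((heig e d).mp hde)
  -- ### the binder: depth `M+1` on the pair, reflected along `f`
  obtain ⟨m₀, hm⟩ := exists_regular_torsion_of_Δ_neg W hK hΔ hc hc₀ (M := M + 1) (Nat.le_add_left 1 M)
  have hA' : ∀ ℓ, (IsKolyvaginPrime N W K 2 ℓ ∧ FrobEqFrobInfty W K (2 ^ (M + 1)) ℓ ∧ S ℓ) →
      ∀ v, v ∈ Sd.A ℓ ↔ f v ∈ pairA (N := N) W c M ε ℓ := fun ℓ hℓ ↦ hA ℓ ((hKol ℓ).mpr hℓ)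
  have hCeb : ∀ (T : Finset V') (g₁ g₂ : V') (ν : ℤ) (I : ℕ), (ν = 1 ∨ ν = -1) → g₁ ∈ Sd.eig ν →
      g₂ ∈ Sd.eig (-ν) → (∀ t ∈ T, ∃ e : ℤ, (e = 1 ∨ e = -1) ∧ t ∈ Sd.eig e) →
      (g₁ ≠ 0 → ((Sd.p : ℤ) ^ (Sd.expo g₁ - 1)) • g₁ ∉ Δ' ⊔ AddSubgroup.closure (T : Set V')) →
      (1 ≤ I → ∀ d ∈ Δ', ∀ u ∈ AddSubgroup.closure (T : Set V'), u ∈ Sd.eig (-ν) →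
        ∀ v ∈ AddSubgroup.closure (T : Set V'), v ∈ Sd.eig ν → (Sd.p : ℤ) • v = 0 →
        ((Sd.p : ℤ) ^ (I - 1)) • g₂ ≠ d + u + v) →
      ∀ b : ℕ, ∃ ℓ, b < ℓ ∧ Sd.Kol ℓ ∧
        (∀ t ∈ AddSubgroup.closure (T : Set V'), t ∈ Sd.A ℓ) ∧
        (∀ j < Sd.expo g₁, ((Sd.p : ℤ) ^ j) • g₁ ∉ Sd.A ℓ) ∧
        (∀ i < I, ((Sd.p : ℤ) ^ i) • g₂ ∉ Sd.A ℓ) := by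
    intro T g₁ g₂ ν I hν hg₁ hg₂ hT H1 H2 b
    have he₁ : addOrderOf g₁ = 2 ^ Sd.expo g₁ := by
      have h := Sd.addOrderOf_eq_pow_expo g₁
      rwa [hp] at h
    rw [hp] at H1 H2
    obtain ⟨ℓ, hbℓ, hgood, hpool, hfull, hge⟩ :=
      binder_of_injective f hf (pairEig W c M ε) (pairDelta W c M ε) (pairA (N := N) W c M ε)
        (fun ℓ ↦ IsKolyvaginPrime N W K 2 ℓ ∧ FrobEqFrobInfty W K (2 ^ (M + 1)) ℓ ∧ S ℓ)
        Sd.eig Δ' Sd.A heig hΔ' hA'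
        (fun T' g₁' g₂' ν' I' e₁ hν' hg₁' hg₂' hT'' he₁' H1' H2' b₀ ↦
          cebotarev_binder_pair_succ W c M hC hK hρ hΔK hc hc₀ hzfix hcomm hS m₀ hm hP₀ hε T' g₁' g₂'
            ν' I' e₁ hν' hg₁' hg₂' hT'' he₁' H1' H2' b₀)
        T g₁ g₂ ν I (Sd.expo g₁) hν hg₁ hg₂ hT he₁ H1 H2 b
    refine ⟨ℓ, hbℓ, (hKol ℓ).mpr hgood, hpool, ?_, ?_⟩
    · intro j hj
      rw [hp]
      exact hfull j hj
    · intro i hi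
      rw [hp]
      exact hge i hi
  -- ### the kill clause: `p^k` kills the isotropic subgroup `Zp' ⊔ Zm'`
  have hkill : ∀ w ∈ Zp' ⊔ Zm', ((Sd.p : ℤ) ^ k) • w = 0 := by
    intro w hw
    obtain ⟨a, ha, b, hb, rfl⟩ := hdec w hw
    rw [hp, ← Nat.cast_pow, natCast_zsmul, smul_add, ← map_nsmul, ← map_nsmul, hkZp a ha, hpB,
      map_zero, map_zero, add_zero]
  have hCTV' : ∀ ℓ m : ℕ, Sd.Kol ℓ → KolSupp Sd.Kol (ℓ * m) → ¬ ℓ ∣ m →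
      ∀ (j N' a b : ℕ) (t : V') (ht : t ∈ Sd.Sel) (hz : ((Sd.p : ℤ) ^ j) • Sd.c (ℓ * m) ∈ Sd.Sel),
      ((Sd.p : ℤ) ^ j) • Sd.c (ℓ * m) ∈ Zp' ⊔ Zm' → t ∈ Zp' ⊔ Zm' →
      ((Sd.p : ℤ) ^ N') • t = 0 → t ∈ Sd.eig (Sd.ε * (-1) ^ (ℓ * m).primeFactors.card) →
      (∀ q ∈ m.primeFactors, t ∈ Sd.A q) → Sd.M - Sd.M₀ ≤ j → N' + Sd.M₀ ≤ Sd.M → N' ≤ j →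
      a + b + 1 = N' →
      ((Sd.p : ℤ) ^ (a + (j - N'))) • Sd.c m ∉ Sd.A ℓ → ((Sd.p : ℤ) ^ b) • t ∉ Sd.A ℓ →
      P ⟨_, hz⟩ ⟨t, ht⟩ ≠ 0 :=
    fun ℓ m hℓ hs hnd j N' a b t ht hz _ htW ↦ hCTV ℓ m hℓ hs hnd j N' a b t ht hz (hkill t htW)
  -- ### the telescope, squared
  have h := card_mul_card_le_of_casselsTate_adaptive_memW Sd Zp' Zm' P hCTV' Δ' hΔpure hCeb hZpε hZmε
    hiso hind hIND hroom
  rw [hp, hZp', hZm', AddSubgroup.card_map_of_injective hJ₁, AddSubgroup.card_map_of_injective hJ₂] at h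
  calc Nat.card A * Nat.card S₂ = (Nat.card Zp * Nat.card Zm) ^ 2 := by rw [mul_pow, hcardA, hcardB]
    _ ≤ (2 ^ Sd.M₀) ^ 2 := Nat.pow_le_pow_left h 2
    _ = 2 ^ (2 * Sd.M₀) := by rw [← pow_mul, mul_comm]

end Summit.BirchSwinnertonDyer.BirchSwinnertonDyer.Theorems.KolyvaginPairDataTwo

end
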